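import Mathlib
import Literature.NumberTheory.Transcendental.LinEDS
import Literature.NumberTheory.Transcendental.LinEDSCode
import HarnessLib

/-!
# `KernelModuloPeriodConjecture`, line `Sketch`: bit-level semantics of the divergent-word fold (E3)

Crux `FurushoPentagon.KernelModuloPeriodConjecture` (stmt-KontsevichZagierPeriods-15058), line
`Sketch`, registered stub `stub_foldDiv_testBit` (skeleton v11, lead c5) of the soundness chain of
the kernel-checkable GF(2) rank engine for the linearised extended double shuffle system
(`Literature/NumberTheory/Transcendental/LinEDS.lean`, §2). A row is a bitset `R` of codes of binary
words of length `k`: codes `< 2^(k-1)` are the convergent words (first letter `x`), codes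
`2^(k-1) + u` with `u < 2^(k-2)` the divergent words `y x u`. `LinEDS.foldDiv k R` XORs, for every
divergent word met, the `k-1` codes `LinEDS.insY u j` (`j = 0, …, k-2`: insert a `y` above the `j`
lowest letters of `u`) into the convergent part. We prove the exact bit-level semantics of this
purely arithmetical algorithm:

* `foldDivE3_testBit_insAll` — bit `c` of `insAll u m acc` is bit `c` of `acc` XOR the parity of
  `#{j ≤ m : insY u j = c}`;
* `foldDivE3_testBit_divScan` — bit `c` of the divide-and-conquer scan `divScan m d base hi acc`
  (`hi < 2^(2^d)`) is bit `c` of `acc` XOR the parity of `Σ_{i < 2^d, i ∈ hi} #{j ≤ m : insY (base+i) j = c}`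
  (induction on `d`: the window splits into its low half `hi % 2^(2^d)` and its high half
  `hi >>> 2^d`, base shifted by `2^d`; empty windows contribute nothing);
* `foldDivE3_insY_lt` — inserted codes stay below `2^(k-1)`;
* `stub_foldDiv_testBit` — the registered statement.

Everything here is elementary bit arithmetic. [folklore]
-/

namespace Summit.KontsevichZagierPeriods.FurushoPentagon.KernelModuloPeriodConjecture

open Literature.NumberTheory.Transcendental

/-- Three-term Boolean XOR bookkeeping: `(a ⊕ p) ⊕ q = a ⊕ (q ⊕ p)`. [folklore] -/
theorem foldDivE3_xor_xor_comm (a p q : Bool) : ((a ^^ p) ^^ q) = (a ^^ (q ^^ p)) := by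
  cases a <;> cases p <;> cases q <;> rfl

/-- **Bits of `insAll`.** Bit `c` of `insAll u m acc` (XOR into `acc` of the codes `insY u j`,
`j = 0, …, m`) is bit `c` of `acc` XOR the parity of `#{j ≤ m : insY u j = c}`. [folklore] -/
theorem foldDivE3_testBit_insAll (u c : ℕ) :
    ∀ (m acc : ℕ), (LinEDS.insAll u m acc).testBit c =
      (acc.testBit c ^^ Nat.bodd (∑ j ∈ Finset.range (m + 1), if LinEDS.insY u j = c then 1 else 0))
  | 0, acc => by
    rw [LinEDS.insAll, Finset.sum_range_one, Nat.testBit_xor, Nat.testBit_two_pow]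
    by_cases h : LinEDS.insY u 0 = c <;> simp [h]
  | m + 1, acc => by
    rw [LinEDS.insAll, foldDivE3_testBit_insAll u c m, Finset.sum_range_succ _ (m + 1),
      Nat.bodd_add, Nat.testBit_xor, Nat.testBit_two_pow]
    by_cases h : LinEDS.insY u (m + 1) = c
    · simp only [h, decide_true, if_true, Nat.bodd_one]
      exact foldDivE3_xor_xor_comm _ _ _
    · simp [h]

/-- **Bits of `divScan`.** For a window `hi < 2^(2^d)` (bit `i` of `hi` = the word with code
`base + i`), bit `c` of `divScan m d base hi acc` is bit `c` of `acc` XOR the parity of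
`Σ_{i < 2^d, bit i of hi set} #{j ≤ m : insY (base + i) j = c}`. [folklore] -/
theorem foldDivE3_testBit_divScan (m c : ℕ) :
    ∀ (d base hi acc : ℕ), hi < 2 ^ 2 ^ d → (LinEDS.divScan m d base hi acc).testBit c =
      (acc.testBit c ^^ Nat.bodd (∑ i ∈ Finset.range (2 ^ d), if hi.testBit i then
        ∑ j ∈ Finset.range (m + 1), (if LinEDS.insY (base + i) j = c then 1 else 0) else 0))
  | 0, base, hi, acc, hhi => by
    have h2 : hi < 2 := by simpa using hhi
    rw [LinEDS.divScan]
    rcases (show hi = 0 ∨ hi = 1 by omega) with rfl | rfl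
    · simp
    · simp [foldDivE3_testBit_insAll]
  | d + 1, base, hi, acc, hhi => by
    rw [LinEDS.divScan]
    by_cases h0 : hi = 0
    · subst h0
      simp
    · have hb : (hi == 0) = false := by simpa using h0
      rw [hb, cond_false]
      rw [Nat.two_pow_succ d, pow_add] at hhi
      have hhi' : hi >>> 2 ^ d < 2 ^ 2 ^ d := by
        rw [Nat.shiftRight_eq_div_pow, Nat.div_lt_iff_lt_mul (by positivity)]
        exact hhi
      rw [foldDivE3_testBit_divScan m c d base _ _ (Nat.mod_lt _ (by positivity)),
        foldDivE3_testBit_divScan m c d (base + 2 ^ d) _ _ hhi', Nat.two_pow_succ d,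
        Finset.sum_range_add, Nat.bodd_add]
      have hlo : (∑ i ∈ Finset.range (2 ^ d), if (hi % 2 ^ 2 ^ d).testBit i then
            ∑ j ∈ Finset.range (m + 1), (if LinEDS.insY (base + i) j = c then 1 else 0) else 0) =
          ∑ i ∈ Finset.range (2 ^ d), if hi.testBit i then
            ∑ j ∈ Finset.range (m + 1), (if LinEDS.insY (base + i) j = c then 1 else 0) else 0 := by
        refine Finset.sum_congr rfl fun i hi => ?_
        rw [Finset.mem_range] at hi
        simp only [Nat.testBit_mod_two_pow, hi, decide_true, Bool.true_and]
      have hhigh : (∑ i ∈ Finset.range (2 ^ d), if (hi >>> 2 ^ d).testBit i then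
            ∑ j ∈ Finset.range (m + 1), (if LinEDS.insY (base + 2 ^ d + i) j = c then 1 else 0)
              else 0) =
          ∑ i ∈ Finset.range (2 ^ d), if hi.testBit (2 ^ d + i) then
            ∑ j ∈ Finset.range (m + 1), (if LinEDS.insY (base + (2 ^ d + i)) j = c then 1 else 0)
              else 0 := by
        simp only [Nat.testBit_shiftRight, Nat.add_assoc]
      rw [hlo, hhigh]
      exact foldDivE3_xor_xor_comm _ _ _

/-- **Inserted codes stay short**: for `u < 2^n` and `j ≤ n`, `insY u j < 2^(n+1)` (inserting one
letter into a word of length `n` gives a word of length `n+1`). [folklore] -/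
theorem foldDivE3_insY_lt {u n j : ℕ} (hu : u < 2 ^ n) (hj : j ≤ n) :
    LinEDS.insY u j < 2 ^ (n + 1) := by
  unfold LinEDS.insY
  refine Nat.or_lt_two_pow (Nat.or_lt_two_pow ?_ ?_) ?_
  · rw [Nat.shiftLeft_eq, Nat.shiftRight_eq_div_pow]
    have h1 : u / 2 ^ j < 2 ^ (n - j) := by
      rw [Nat.div_lt_iff_lt_mul (by positivity), ← pow_add, Nat.sub_add_cancel hj]
      exact hu
    calc u / 2 ^ j * 2 ^ (j + 1) < 2 ^ (n - j) * 2 ^ (j + 1) :=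
          Nat.mul_lt_mul_of_pos_right h1 (by positivity)
      _ = 2 ^ (n + 1) := by rw [← pow_add]; congr 1; omega
  · exact Nat.pow_lt_pow_right (by norm_num) (by omega)
  · exact lt_of_lt_of_le (Nat.mod_lt _ (by positivity))
      (Nat.pow_le_pow_right (by norm_num) (by omega))

/-- **E3 — fold parity (bit level)** (registered stub `stub_foldDiv_testBit` of line `Sketch`).
For a set `R` of length-`k` codes whose members above `2^(k-1)` lie below `2^(k-1) + 2^(k-2)`
(one leading `y`, then `x`), bit `c` of `foldDiv k R` is set iff `c < 2^(k-1)` and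
`[c ∈ R] + Σ_{u : 2^(k-1)+u ∈ R} #{j ≤ k-2 : insY u j = c}` is odd. [folklore] -/
theorem stub_foldDiv_testBit :
    ∀ (k R : ℕ), 2 ≤ k →
      (∀ i, R.testBit i = true → i < 2 ^ (k - 1) ∨ (2 ^ (k - 1) ≤ i ∧ i < 2 ^ (k - 1) + 2 ^ (k - 2))) →
      ∀ c : ℕ, (LinEDS.foldDiv k R).testBit c = true ↔ c < 2 ^ (k - 1) ∧
        Odd ((if R.testBit c then 1 else 0) + ∑ u ∈ Finset.range (2 ^ (k - 2)),
          if R.testBit (2 ^ (k - 1) + u) then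
            ((Finset.range (k - 1)).filter fun j => LinEDS.insY u j = c).card else 0) := by
  intro k R hk _hR c
  obtain ⟨m, rfl⟩ : ∃ m, k = m + 2 := ⟨k - 2, by omega⟩
  have h1 : m + 2 - 1 = m + 1 := rfl
  simp only [Nat.add_sub_cancel, h1, LinEDS.foldDiv]
  rw [foldDivE3_testBit_divScan m c m 0 _ _ (Nat.mod_lt _ (by positivity))]
  have hS : (∑ i ∈ Finset.range (2 ^ m), if ((R >>> 2 ^ (m + 1)) % 2 ^ 2 ^ m).testBit i then
        ∑ j ∈ Finset.range (m + 1), (if LinEDS.insY (0 + i) j = c then 1 else 0) else 0) =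
      ∑ u ∈ Finset.range (2 ^ m), if R.testBit (2 ^ (m + 1) + u) then
        ((Finset.range (m + 1)).filter fun j => LinEDS.insY u j = c).card else 0 := by
    refine Finset.sum_congr rfl fun i hi => ?_
    rw [Finset.mem_range] at hi
    simp only [Nat.testBit_mod_two_pow, hi, decide_true, Bool.true_and, Nat.testBit_shiftRight,
      Nat.zero_add, Finset.card_filter]
  rw [hS, Nat.testBit_mod_two_pow]
  by_cases hc : c < 2 ^ (m + 1)
  · have hbodd : ∀ n : ℕ, n.bodd = true ↔ Odd n := fun n => by
      rw [Nat.odd_iff, Nat.mod_two_of_bodd]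
      cases n.bodd <;> simp
    simp only [hc, decide_true, Bool.true_and, true_and]
    rw [← hbodd, Nat.bodd_add]
    cases R.testBit c <;> simp
  · have hS0 : (∑ u ∈ Finset.range (2 ^ m), if R.testBit (2 ^ (m + 1) + u) then
        ((Finset.range (m + 1)).filter fun j => LinEDS.insY u j = c).card else 0) = 0 := by
      refine Finset.sum_eq_zero fun u hu => ?_
      rw [Finset.mem_range] at hu
      rw [Finset.card_eq_zero.mpr (Finset.filter_eq_empty_iff.mpr fun j hj => ?_), ite_self]
      rw [Finset.mem_range] at hj
      exact (lt_of_lt_of_le (foldDivE3_insY_lt hu (by omega)) (Nat.le_of_not_lt hc)).ne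
    rw [hS0]
    simp [hc]

end Summit.KontsevichZagierPeriods.FurushoPentagon.KernelModuloPeriodConjecture
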